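import Literature.NumberTheory.EllipticCurves.ProfiniteGroupDistributionComap
import Literature.NumberTheory.EllipticCurves.ProfiniteGroupDistributionDivision
import HarnessLib

/-!
# The pull-back `comap` is EQUIVARIANT under `U_0`: translating a cell `a ⊆ U_0` by `h ∈ U_0` on the
# group side is a translation `τ` of cells on the profinite side (de Shalit 1987, I.3.3 (9)/I.3.4 (ii):
# `G` acts on measures on `ℤ_p^×` through `κ`)

De Shalit 1987, I.3.4 Lemma (ii) (p. 18): "`μ_{σ(β)} = σμ_β`, where `G` acts on `Λ` via `κ : G ≅ ℤ_p^×`";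
I.3.3 (9): the measures on `G` are those on `ℤ_p^×` transported by `κ`.

`ProfiniteGroupDistributionComap.lean` transports a bounded distribution `ν` on a profinite tower `T`
to `U_0 ≤ G` along cell maps `ψ_n : G/U_n → T.Cell n` (`κ mod p^{n+1}`).
`ProfiniteGroupDistributionInduction.lean` extends the resulting family `β ↦ D β` from `U_0` to `G`
(`induce`) under the `U_0`-equivariance hypothesis
`hD : ∀ h ∈ U_0, (D (h • β)).μ n (proj n h · a) = (D β).μ n a` (cells `a ⊆ U_0`).
This file reduces `hD` for `D β = comap (ν β) ψ` to the profinite side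
(**`comap_μ_proj_mul_of_μ_translate`**): if `ψ_n(h·a) = τ_n(ψ_n a)` on the cells `a ⊆ U_0` and
`ν'(τ_n b) = ν(b)` for all cells `b`, then `(comap ν')(h·a) = (comap ν)(a)` for `a ⊆ U_0` — with
`τ_n = ` multiplication by `κ(h) mod p^{n+1}` and `ν' = ν_{h•β}` this is exactly `hD`
(`PAdicOneVariableUnitsSocket.lean` supplies `ν'(κ(h) b) = ν(b)` for the log-free socket).

Everything is a theorem; no named facts, no instances, no `sorry`.

## References

* [deShalit1987] E. de Shalit, *Iwasawa theory of elliptic curves with complex multiplication* (1987),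
  I.3.3 (9), I.3.4 Lemma (ii) (p. 18), II.4.6 (p. 59).
-/

noncomputable section

open Filter
open scoped Topology Classical

namespace Literature.NumberTheory.EllipticCurves

namespace GroupDistribution

variable {G : Type*} [Group G] {𝒰 : SubgroupTower G} [∀ n, (𝒰.U n).Normal]
variable {X : Type*} [PseudoMetricSpace X] {T : ProfiniteTower X}
variable {𝕜 : Type*} [NormedField 𝕜]

/-- Translating a cell inside `U_0` by `h ∈ U_0` keeps it inside `U_0`.
[cite: deShalit1987, I.3.3 (9) (p. 18)] -/
theorem transLE_proj_mul_eq_one {h : G} (hh : h ∈ 𝒰.U 0) {n : ℕ} {a : G ⧸ 𝒰.U n}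
    (ha : 𝒰.transLE (Nat.zero_le n) a = 1) : 𝒰.transLE (Nat.zero_le n) (𝒰.proj n h * a) = 1 := by
  rw [𝒰.transLE_mul, ha, mul_one, 𝒰.transLE_proj, 𝒰.proj_eq_one_of_mem le_rfl hh]

/-- **`U_0`-equivariance of the pull-back.** Let `ν, ν'` be bounded distributions on `T`, `h ∈ U_0`,
and `τ_n : T.Cell n → T.Cell n` with `ψ_n(h · a) = τ_n(ψ_n a)` for the cells `a ⊆ U_0` and
`ν'(τ_n b) = ν(b)` for all cells `b`. Then `(comap ν' ψ)(h · a) = (comap ν ψ)(a)` for every cell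
`a ⊆ U_0` — the hypothesis `hD` of `GroupDistribution.induce_μ_of_transLE_eq_one` for
`D β = comap (ν_β) ψ`, `ν' = ν_{h•β}`. [cite: deShalit1987, I.3.4 Lemma (ii) (p. 18), II.4.6 (p. 59)] -/
theorem comap_μ_proj_mul_of_μ_translate (ν ν' : BoundedDistribution T 𝕜)
    (ψ : (n : ℕ) → G ⧸ 𝒰.U n → T.Cell n) (hψ) (hinj) (hsurj) {h : G} (hh : h ∈ 𝒰.U 0)
    (τ : (n : ℕ) → T.Cell n → T.Cell n)
    (hψτ : ∀ (n : ℕ) (a : G ⧸ 𝒰.U n), 𝒰.transLE (Nat.zero_le n) a = 1 →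
      ψ n (𝒰.proj n h * a) = τ n (ψ n a))
    (hν : ∀ (n : ℕ) (b : T.Cell n), ν'.μ n (τ n b) = ν.μ n b)
    (n : ℕ) (a : G ⧸ 𝒰.U n) (ha : 𝒰.transLE (Nat.zero_le n) a = 1) :
    (comap ν' ψ hψ hinj hsurj).μ n (𝒰.proj n h * a) = (comap ν ψ hψ hinj hsurj).μ n a := by
  rw [comap_μ_of_transLE_eq_one ν' ψ hψ hinj hsurj n _ (transLE_proj_mul_eq_one hh ha),
    comap_μ_of_transLE_eq_one ν ψ hψ hinj hsurj n a ha, hψτ n a ha, hν]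

/-- The same packaged as the hypothesis `hD` of `GroupDistribution.induce`: for a `G`-set `B`, a family
`ν : B → BoundedDistribution T 𝕜`, translations `τ_n(h) : T.Cell n → T.Cell n` (`h ∈ U_0`) with
`ψ_n(h · a) = τ_n(h)(ψ_n a)` on `U_0` and `ν_{h•β}(τ_n(h) b) = ν_β(b)`, the family `β ↦ comap (ν β) ψ` is
`U_0`-equivariant. [cite: deShalit1987, I.3.4 Lemma (ii) (p. 18), II.4.6 (p. 59)] -/
theorem comap_family_equivariant {B : Type*} [SMul G B] (ν : B → BoundedDistribution T 𝕜)
    (ψ : (n : ℕ) → G ⧸ 𝒰.U n → T.Cell n) (hψ) (hinj) (hsurj)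
    (τ : G → (n : ℕ) → T.Cell n → T.Cell n)
    (hψτ : ∀ h ∈ 𝒰.U 0, ∀ (n : ℕ) (a : G ⧸ 𝒰.U n), 𝒰.transLE (Nat.zero_le n) a = 1 →
      ψ n (𝒰.proj n h * a) = τ h n (ψ n a))
    (hν : ∀ h ∈ 𝒰.U 0, ∀ (β : B) (n : ℕ) (b : T.Cell n), (ν (h • β)).μ n (τ h n b) = (ν β).μ n b) :
    ∀ h ∈ 𝒰.U 0, ∀ (β : B) (n : ℕ) (a : G ⧸ 𝒰.U n), 𝒰.transLE (Nat.zero_le n) a = 1 →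
      (comap (ν (h • β)) ψ hψ hinj hsurj).μ n (𝒰.proj n h * a) = (comap (ν β) ψ hψ hinj hsurj).μ n a :=
  fun h hh β n a ha ↦ comap_μ_proj_mul_of_μ_translate (ν β) (ν (h • β)) ψ hψ hinj hsurj hh (τ h)
    (hψτ h hh) (hν h hh β) n a ha

end GroupDistribution

end Literature.NumberTheory.EllipticCurves

end
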